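import Literature.NumberTheory.Sieve.AsymptoticSieveForPrimesInputs
import Literature.NumberTheory.Sieve.FriedlanderIwaniecPrimesCrudeBound
import HarnessLib

/-!
# Friedlander–Iwaniec, *The polynomial `X² + Y⁴` captures its primes*, Lemma 2.2 (sum form) and pair root counts

Family `parity`, statement parity.S17. Source: J. Friedlander, H. Iwaniec, Ann. of Math. (2) 148 (1998),
945–1040 [FriedlanderIwaniecAnnals1998], §2, Lemma 2.2, third statement: "For any `n ≥ 1` we also have
`τ(n) ≤ 9 Σ_{d ∣ n, d ≤ n^{1/3}} τ(d)`. … we note that `τ₃(n) ≤ 3 Σ_{d∣n, d ≤ n^{1/3}} τ(n/d)`, and hence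
by Cauchy's inequality `t(n) = τ₃(n)² (Σ_{d∣n} τ(n/d)² τ(d)⁻¹)⁻¹ ≤ 9 Σ_{d∣n, d ≤ n^{1/3}} τ(d)`. On
the other hand we have `t(n) ≥ τ(n)` which, due to multiplicativity, can be checked by verifying on
prime powers." It is the tool of the "trivial bounds" (5.16), (10.7) etc., replacing `τ(|z|²)` by short
divisors of `|z|²` on thin regions.

Everything here is PROVED. The sum form is proved for SQUAREFREE `n` (the case needed for `|z|²`
squarefree, where `t(n) = τ(n)` exactly); the tree's `SmallDivisorLemma` has the first ("there is a
divisor") statement of Lemma 2.2.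

## Contents

* `triples n` (ordered factorisations `n = abc` as `(a, b)`), `card_triples` (`= τ₃(n)`,
  `divisorCountK 3`), `smallDivisors n` (`d ∣ n`, `d³ ≤ n`), `divisorCountK_three_le`:
  `τ₃(n) ≤ 3 Σ_{d ∣ n, d³ ≤ n} τ(n/d)` for all `n ≥ 1` (one factor of a triple is `≤ n^{1/3}`; an
  explicit injection into `3 × {(d, e)}`);
* `invTauCube` (`τ⁻³`, multiplicative), `sum_divisors_invTauCube` (`Σ_{d∣n} τ(d)⁻³ = (9/8)^{ω(n)}`
  for squarefree `n`), `card_divisors_div_mul`, and **`card_divisors_le_nine_mul_sum`**: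
  `τ(n) ≤ 9 Σ_{d ∣ n, d³ ≤ n} τ(d)` for squarefree `n` (Cauchy–Schwarz as in the source);
* `pairCongrCount d = #{(a, b) mod d : d ∣ a² + b²}`, `pairCongrCount_prime_le` (`N(p) ≤ 2p`),
  `pairCongrCount_mul_le` (CRT), **`pairCongrCount_le_of_squarefree`** (`N(d) ≤ τ(d) d`) — the
  number of residue classes of Gaussian integers `z (mod d)` with `d ∣ |z|²`, for counting such `z`
  in boxes.

## References

* J. Friedlander, H. Iwaniec, Ann. of Math. (2) 148 (1998), 945–1040, Lemma 2.2.
  [FriedlanderIwaniecAnnals1998]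

## Tree / Mathlib

Tree: `divisorCountK`, `divisorCountK_succ_apply`, `divisorCountK_two`,
`divisorCountK_apply_of_squarefree`, `card_primeFactors_eq_cardDistinctFactors`
(`AsymptoticSieveForPrimesInputs`); `sqCongrCount`, `sqCongrCount_prime_le` (`…CrudeBound`).
Mathlib: `ArithmeticFunction.IsMultiplicative.prodPrimeFactors_one_add_of_squarefree`,
`Finset.sum_mul_sq_le_sq_mul_sq`, `Nat.sum_div_divisors`, `Nat.recOnPosPrimePosCoprime`,
`Nat.modEq_and_modEq_iff_modEq_mul`.
-/

open Finset
open scoped ArithmeticFunction.sigma ArithmeticFunction.omega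

namespace Literature.NumberTheory.Sieve.FriedlanderIwaniecPrimes

/-! ### `τ₃(n)` as ordered factorisations, and the small factor of a triple -/

/-- The ordered factorisations `n = a · b · c` as pairs `(a, b)` with `a ∣ n`, `b ∣ n/a`. [folklore] -/
def triples (n : ℕ) : Finset (Σ _ : ℕ, ℕ) := n.divisors.sigma fun a => (n / a).divisors

/-- `#triples n = Σ_{a ∣ n} τ(n/a) = τ₃(n)`. [folklore] -/
theorem card_triples (n : ℕ) : #(triples n) = divisorCountK 3 n := by
  rw [triples, card_sigma, show (3 : ℕ) = 2 + 1 from rfl, divisorCountK_succ_apply, divisorCountK_two]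
  have h := Nat.sum_div_divisors n (fun d => #d.divisors)
  rw [h]
  simp [ArithmeticFunction.sigma_zero_apply]

/-- The divisors `d ∣ n` with `d³ ≤ n` (`d ≤ n^{1/3}`). [cite: FriedlanderIwaniecAnnals1998, Lemma 2.2] -/
def smallDivisors (n : ℕ) : Finset ℕ := n.divisors.filter fun d => d ^ 3 ≤ n

/-- In every ordered factorisation `n = abc` one factor is `≤ n^{1/3}`; recording which one and the
remaining data injects the triples into `3 × {(d, e) : d ∣ n, d³ ≤ n, e ∣ n/d}`:
`τ₃(n) ≤ 3 Σ_{d ∣ n, d³ ≤ n} τ(n/d)` ("we note that `τ₃(n) ≤ 3 Σ_{d∣n, d ≤ n^{1/3}} τ(n/d)`").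
[cite: FriedlanderIwaniecAnnals1998, Lemma 2.2 (proof)] -/
theorem divisorCountK_three_le (n : ℕ) (hn : n ≠ 0) :
    divisorCountK 3 n ≤ 3 * ∑ d ∈ smallDivisors n, #(n / d).divisors := by
  classical
  rw [← card_triples]
  set U : Finset (Fin 3 × (Σ _ : ℕ, ℕ)) :=
    (univ : Finset (Fin 3)) ×ˢ ((smallDivisors n).sigma fun d => (n / d).divisors) with hU
  have hcardU : #U = 3 * ∑ d ∈ smallDivisors n, #(n / d).divisors := by
    rw [hU, card_product, card_univ, Fintype.card_fin, card_sigma]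
  rw [← hcardU]
  -- the map
  let F : (Σ _ : ℕ, ℕ) → Fin 3 × (Σ _ : ℕ, ℕ) := fun x =>
    if x.1 ^ 3 ≤ n then (0, ⟨x.1, x.2⟩)
    else if x.2 ^ 3 ≤ n then (1, ⟨x.2, x.1⟩)
    else (2, ⟨n / (x.1 * x.2), x.1⟩)
  -- basic facts about a triple
  have hfacts : ∀ x ∈ triples n, x.1 * x.2 ∣ n ∧ 0 < x.1 ∧ 0 < x.2 ∧
      n = x.1 * x.2 * (n / (x.1 * x.2)) := by
    intro x hx
    obtain ⟨ha, hb⟩ := mem_sigma.mp hx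
    have ha' := Nat.dvd_of_mem_divisors ha
    have hb' := Nat.dvd_of_mem_divisors hb
    have hab : x.1 * x.2 ∣ n := Nat.mul_dvd_of_dvd_div ha' hb'
    have ha0 : 0 < x.1 := Nat.pos_of_mem_divisors ha
    have hb0 : 0 < x.2 := Nat.pos_of_mem_divisors hb
    exact ⟨hab, ha0, hb0, (Nat.mul_div_cancel' hab).symm⟩
  refine card_le_card_of_injOn F (fun x hx => ?_) ?_
  · -- `F` maps into `U`
    obtain ⟨hab, ha0, hb0, habc⟩ := hfacts x hx
    obtain ⟨ha, hb⟩ := mem_sigma.mp hx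
    have ha' := Nat.dvd_of_mem_divisors ha
    rw [mem_coe, hU, mem_product]
    refine ⟨mem_univ _, ?_⟩
    simp only [F]
    split_ifs with h1 h2
    · exact mem_sigma.mpr ⟨mem_filter.mpr ⟨ha, h1⟩, hb⟩
    · refine mem_sigma.mpr ⟨mem_filter.mpr ⟨Nat.mem_divisors.mpr ⟨?_, hn⟩, h2⟩,
        Nat.mem_divisors.mpr ⟨?_, ?_⟩⟩
      · exact (Dvd.intro_left _ rfl).trans hab
      · exact Nat.dvd_div_of_mul_dvd (by rwa [mul_comm] at hab)
      · exact Nat.div_ne_zero_iff_of_dvd ((Dvd.intro_left _ rfl).trans hab) |>.mpr ⟨hn, hb0.ne'⟩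
    · set c := n / (x.1 * x.2) with hc
      have hc0 : 0 < c := by
        rcases Nat.eq_zero_or_pos c with h | h
        · exfalso; rw [h, mul_zero] at habc; exact hn habc
        · exact h
      have hcdvd : c ∣ n := ⟨x.1 * x.2, by rw [mul_comm]; exact habc⟩
      have hc3 : c ^ 3 ≤ n := by
        by_contra hlt
        rw [not_le] at h1 h2 hlt
        have : n ^ 3 < n ^ 3 := by
          calc n ^ 3 = n * n * n := by ring
            _ < x.1 ^ 3 * x.2 ^ 3 * c ^ 3 := by
                apply Nat.mul_lt_mul'' (Nat.mul_lt_mul'' h1 h2) hlt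
            _ = (x.1 * x.2 * c) ^ 3 := by ring
            _ = n ^ 3 := by rw [← habc]
        exact lt_irrefl _ this
      refine mem_sigma.mpr ⟨mem_filter.mpr ⟨Nat.mem_divisors.mpr ⟨hcdvd, hn⟩, hc3⟩,
        Nat.mem_divisors.mpr ⟨?_, ?_⟩⟩
      · have : n / c = x.1 * x.2 := by
          rw [Nat.div_eq_iff_eq_mul_left hc0 hcdvd]; exact habc
        rw [this]; exact Dvd.intro _ rfl
      · exact (Nat.div_ne_zero_iff_of_dvd hcdvd).mpr ⟨hn, hc0.ne'⟩
  · -- `F` is injective on the triples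
    rintro ⟨a, b⟩ hx ⟨a', b'⟩ hy h
    obtain ⟨habx, hax, hbx, hx3⟩ := hfacts _ hx
    obtain ⟨haby, hay, hby, hy3⟩ := hfacts _ hy
    simp only at hax hbx hx3 hay hby hy3
    have htag := congrArg Prod.fst h
    have hpay := congrArg Prod.snd h
    by_cases hx1 : a ^ 3 ≤ n <;> by_cases hy1 : a' ^ 3 ≤ n
    · simp only [F, hx1, hy1, if_true] at hpay
      exact hpay
    · by_cases hy2 : b' ^ 3 ≤ n <;>
        simp only [F, hx1, hy1, hy2, if_true, if_false, Fin.ext_iff, Fin.val_zero, Fin.val_one,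
          Fin.val_two] at htag <;> omega
    · by_cases hx2 : b ^ 3 ≤ n <;>
        simp only [F, hx1, hy1, hx2, if_true, if_false, Fin.ext_iff, Fin.val_zero, Fin.val_one,
          Fin.val_two] at htag <;> omega
    · by_cases hx2 : b ^ 3 ≤ n <;> by_cases hy2 : b' ^ 3 ≤ n
      · simp only [F, hx1, hy1, hx2, hy2, if_true, if_false, Sigma.mk.inj_iff, heq_eq_eq] at hpay
        obtain ⟨h1, h2⟩ := hpay
        subst h1; subst h2; rfl
      · simp only [F, hx1, hy1, hx2, hy2, if_true, if_false, Fin.ext_iff, Fin.val_one,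
          Fin.val_two] at htag; omega
      · simp only [F, hx1, hy1, hx2, hy2, if_true, if_false, Fin.ext_iff, Fin.val_one,
          Fin.val_two] at htag; omega
      · -- tag 2: `(c, a) = (c', a')`, hence `b = n/(a c) = b'`
        simp only [F, hx1, hy1, hx2, hy2, if_false, Sigma.mk.inj_iff, heq_eq_eq] at hpay
        obtain ⟨hcc, haa⟩ := hpay
        subst haa
        have hc1 : 0 < n / (a * b) := Nat.pos_of_ne_zero fun h0 => hn (by
          rw [h0, mul_zero] at hx3; exact hx3)
        have hc2 : 0 < n / (a * b') := Nat.pos_of_ne_zero fun h0 => hn (by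
          rw [h0, mul_zero] at hy3; exact hy3)
        have hb1 : b = n / (a * (n / (a * b))) := by
          apply (Nat.div_eq_of_eq_mul_left (Nat.mul_pos hax hc1) _).symm
          calc n = a * b * (n / (a * b)) := hx3
            _ = b * (a * (n / (a * b))) := by ring
        have hb2 : b' = n / (a * (n / (a * b'))) := by
          apply (Nat.div_eq_of_eq_mul_left (Nat.mul_pos hax hc2) _).symm
          calc n = a * b' * (n / (a * b')) := hy3
            _ = b' * (a * (n / (a * b'))) := by ring
        have hb : b = b' := by rw [hb1, hb2, hcc]
        subst hb; rfl

/-! ### Lemma 2.2, sum form, for squarefree `n` -/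

/-- The multiplicative function `d ↦ τ(d)⁻³` (real valued; `0 ↦ 0`). [folklore] -/
noncomputable def invTauCube : ArithmeticFunction ℝ :=
  ⟨fun d => if d = 0 then 0 else ((#d.divisors : ℝ))⁻¹ ^ 3, by simp⟩

/-- `invTauCube d = τ(d)⁻³` for `d ≠ 0`. [folklore] -/
theorem invTauCube_apply {d : ℕ} (hd : d ≠ 0) : invTauCube d = ((#d.divisors : ℝ))⁻¹ ^ 3 := by
  simp [invTauCube, hd]

/-- `τ⁻³` is multiplicative. [folklore] -/
theorem isMultiplicative_invTauCube : invTauCube.IsMultiplicative := by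
  refine ⟨by simp [invTauCube], fun {m n} hmn => ?_⟩
  rcases Nat.eq_zero_or_pos m with rfl | hm
  · simp [invTauCube]
  rcases Nat.eq_zero_or_pos n with rfl | hn
  · simp [invTauCube]
  rw [invTauCube_apply (Nat.mul_ne_zero hm.ne' hn.ne'), invTauCube_apply hm.ne', invTauCube_apply hn.ne',
    Nat.Coprime.card_divisors_mul hmn]
  push_cast
  rw [mul_inv, mul_pow]

/-- `Σ_{d ∣ n} τ(d)⁻³ = (9/8)^{ω(n)}` for squarefree `n` (`τ(p) = 2`, `1 + 1/8 = 9/8`). [folklore] -/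
theorem sum_divisors_invTauCube {n : ℕ} (hn : Squarefree n) :
    ∑ d ∈ n.divisors, invTauCube d = (9 / 8 : ℝ) ^ n.primeFactors.card := by
  rw [← isMultiplicative_invTauCube.prodPrimeFactors_one_add_of_squarefree hn, ← prod_const]
  refine prod_congr rfl fun p hp => ?_
  have hpp := Nat.prime_of_mem_primeFactors hp
  rw [invTauCube_apply hpp.ne_zero, hpp.divisors, card_pair hpp.ne_one.symm]
  norm_num

/-- For squarefree `n` and `d ∣ n`: `τ(n/d) τ(d) = τ(n)`. [folklore] -/
theorem card_divisors_div_mul {n d : ℕ} (hn : Squarefree n) (hd : d ∣ n) :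
    #(n / d).divisors * #d.divisors = #n.divisors := by
  have hnd : n / d * d = n := Nat.div_mul_cancel hd
  have hcop : (n / d).Coprime d := Nat.coprime_of_squarefree_mul (by rw [hnd]; exact hn)
  rw [← Nat.Coprime.card_divisors_mul hcop, hnd]

/-- **FI Lemma 2.2, third statement, for squarefree `n`**: `τ(n) ≤ 9 Σ_{d ∣ n, d³ ≤ n} τ(d)`
("by Cauchy's inequality `t(n) = τ₃(n)² (Σ_{d∣n} τ(n/d)² τ(d)⁻¹)⁻¹ ≤ 9 Σ_{d∣n, d ≤ n^{1/3}} τ(d)` …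
`t(n) ≥ τ(n)`"; for squarefree `n`, `t(n) = τ(n)` exactly). The source states it for all `n`; the
squarefree case is the one used for `|z|²` squarefree. [cite: FriedlanderIwaniecAnnals1998, Lemma 2.2] -/
theorem card_divisors_le_nine_mul_sum {n : ℕ} (hn : Squarefree n) :
    (#n.divisors : ℝ) ≤ 9 * ∑ d ∈ smallDivisors n, (#d.divisors : ℝ) := by
  have hn0 : n ≠ 0 := hn.ne_zero
  set k := n.primeFactors.card with hk
  have hτ : (#n.divisors : ℝ) = 2 ^ k := by
    have h := congrArg (fun f : ArithmeticFunction ℕ => f n) divisorCountK_two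
    simp only [ArithmeticFunction.sigma_zero_apply] at h
    rw [← h, divisorCountK_apply_of_squarefree 2 hn, ← card_primeFactors_eq_cardDistinctFactors]
    push_cast; rfl
  have hτ3 : (divisorCountK 3 n : ℝ) = 3 ^ k := by
    rw [divisorCountK_apply_of_squarefree 3 hn, ← card_primeFactors_eq_cardDistinctFactors]; push_cast; rfl
  set D := smallDivisors n with hD
  have hDsub : D ⊆ n.divisors := filter_subset _ _
  set S₀ : ℝ := ∑ d ∈ D, (#(n / d).divisors : ℝ) with hS₀
  set Sp : ℝ := ∑ d ∈ D, (#d.divisors : ℝ) with hSp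
  set W : ℝ := ∑ d ∈ D, (#(n / d).divisors : ℝ) ^ 2 / #d.divisors with hW
  -- (1) `3^k ≤ 3 S₀`
  have h1 : (3 : ℝ) ^ k ≤ 3 * S₀ := by
    have h := divisorCountK_three_le n hn0
    have h' : ((divisorCountK 3 n : ℕ) : ℝ) ≤ ((3 * ∑ d ∈ smallDivisors n, #(n / d).divisors : ℕ) : ℝ) := by
      exact_mod_cast h
    rw [hτ3] at h'
    refine h'.trans_eq ?_
    rw [hS₀]; push_cast; rfl
  -- (2) Cauchy–Schwarz `S₀² ≤ Sp · W`
  have hτpos : ∀ d ∈ D, (0 : ℝ) < #d.divisors := fun d hd =>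
    Nat.cast_pos.mpr (card_pos.mpr ⟨1, Nat.one_mem_divisors.mpr (Nat.pos_of_mem_divisors (hDsub hd)).ne'⟩)
  have h2 : S₀ ^ 2 ≤ Sp * W := by
    have hcs := sum_mul_sq_le_sq_mul_sq D (fun d => Real.sqrt #d.divisors)
      (fun d => (#(n / d).divisors : ℝ) / Real.sqrt #d.divisors)
    have e0 : ∑ d ∈ D, Real.sqrt #d.divisors * ((#(n / d).divisors : ℝ) / Real.sqrt #d.divisors) = S₀ := by
      refine sum_congr rfl fun d hd => ?_
      have := Real.sqrt_pos.mpr (hτpos d hd)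
      field_simp
    have e1 : ∑ d ∈ D, Real.sqrt (#d.divisors : ℝ) ^ 2 = Sp :=
      sum_congr rfl fun d hd => Real.sq_sqrt (hτpos d hd).le
    have e2 : ∑ d ∈ D, ((#(n / d).divisors : ℝ) / Real.sqrt #d.divisors) ^ 2 = W := by
      refine sum_congr rfl fun d hd => ?_
      rw [div_pow, Real.sq_sqrt (hτpos d hd).le]
    rw [e0, e1, e2] at hcs
    exact hcs
  -- (3) `W ≤ (9/2)^k`
  have h3 : W ≤ (9 / 2 : ℝ) ^ k := by
    have hWle : W ≤ ∑ d ∈ n.divisors, (2 : ℝ) ^ k * (2 : ℝ) ^ k * invTauCube d := by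
      calc W = ∑ d ∈ D, (2 : ℝ) ^ k * (2 : ℝ) ^ k * invTauCube d := by
            refine sum_congr rfl fun d hd => ?_
            have hdn := Nat.dvd_of_mem_divisors (hDsub hd)
            have hd0 : d ≠ 0 := (Nat.pos_of_mem_divisors (hDsub hd)).ne'
            have hmul := card_divisors_div_mul hn hdn
            have hτd := hτpos d hd
            have e : (#(n / d).divisors : ℝ) = 2 ^ k / #d.divisors := by
              rw [eq_div_iff hτd.ne', ← hτ]; exact_mod_cast hmul
            rw [e, invTauCube_apply hd0]
            field_simp
        _ ≤ _ := sum_le_sum_of_subset_of_nonneg hDsub fun d hd _ => by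
            have hd0 : d ≠ 0 := (Nat.pos_of_mem_divisors hd).ne'
            rw [invTauCube_apply hd0]; positivity
    refine hWle.trans ?_
    rw [← mul_sum, sum_divisors_invTauCube hn, ← hk]
    rw [show (2 : ℝ) ^ k * 2 ^ k * (9 / 8) ^ k = (2 * 2 * (9 / 8)) ^ k by rw [mul_pow, mul_pow]]
    norm_num
  -- conclusion: `9^k ≤ 9 S₀² ≤ 9 Sp W ≤ 9 Sp (9/2)^k`, i.e. `2^k ≤ 9 Sp`
  have hSp0 : 0 ≤ Sp := sum_nonneg fun _ _ => Nat.cast_nonneg _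
  have h92 : (0 : ℝ) < (9 / 2) ^ k := by positivity
  have hmain : (2 : ℝ) ^ k * (9 / 2) ^ k ≤ 9 * Sp * (9 / 2) ^ k := by
    have e9 : (2 : ℝ) ^ k * (9 / 2) ^ k = (3 ^ k) ^ 2 := by
      rw [← mul_pow, ← pow_mul, show (2 : ℝ) * (9 / 2) = 9 by norm_num, show (9 : ℝ) = 3 ^ 2 by norm_num,
        ← pow_mul, mul_comm]
    rw [e9]
    have h30 : (0 : ℝ) ≤ 3 ^ k := by positivity
    calc ((3 : ℝ) ^ k) ^ 2 ≤ (3 * S₀) ^ 2 := pow_le_pow_left₀ h30 h1 2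
      _ = 9 * S₀ ^ 2 := by ring
      _ ≤ 9 * (Sp * W) := by linarith [h2]
      _ ≤ 9 * (Sp * (9 / 2) ^ k) := by
          have := mul_le_mul_of_nonneg_left h3 hSp0
          linarith
      _ = 9 * Sp * (9 / 2) ^ k := by ring
  rw [hτ]
  exact le_of_mul_le_mul_right hmain h92

/-! ### The number of pairs `(a, b) mod d` with `d ∣ a² + b²` -/

/-- `N(d) = #{(a, b) mod d : a² + b² ≡ 0 (mod d)}`. [folklore] -/
def pairCongrCount (d : ℕ) : ℕ := #(((range d) ×ˢ (range d)).filter fun ab => d ∣ ab.1 ^ 2 + ab.2 ^ 2)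

/-- For a prime `p`: `N(p) ≤ 2p` (for each `b`, at most two `a`). [folklore] -/
theorem pairCongrCount_prime_le {p : ℕ} (hp : p.Prime) : pairCongrCount p ≤ 2 * p := by
  unfold pairCongrCount
  rw [card_filter, sum_product_right]
  calc ∑ b ∈ range p, ∑ a ∈ range p, (if p ∣ a ^ 2 + b ^ 2 then 1 else 0)
      = ∑ b ∈ range p, #((range p).filter fun a => p ∣ a ^ 2 + b ^ 2) := by
        refine sum_congr rfl fun b _ => ?_; rw [card_filter]
    _ ≤ ∑ b ∈ range p, 2 := by
        refine sum_le_sum fun b _ => ?_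
        have h := sqCongrCount_prime_le hp (-((b : ℤ) ^ 2))
        unfold sqCongrCount at h
        refine le_trans (le_of_eq ?_) h
        congr 1
        ext a
        simp only [mem_filter, sub_neg_eq_add]
        refine and_congr_right fun _ => ?_
        exact_mod_cast (Int.natCast_dvd_natCast (m := p) (n := a ^ 2 + b ^ 2)).symm
    _ = 2 * p := by rw [sum_const, card_range, smul_eq_mul, mul_comm]

/-- Sub-multiplicativity on coprime moduli (Chinese remainder theorem, injectivity half):
`N(mn) ≤ N(m) N(n)`. [folklore] -/
theorem pairCongrCount_mul_le {m n : ℕ} (hm : 0 < m) (hn : 0 < n) (hmn : m.Coprime n) :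
    pairCongrCount (m * n) ≤ pairCongrCount m * pairCongrCount n := by
  unfold pairCongrCount
  rw [← card_product]
  refine card_le_card_of_injOn (fun ab => ((ab.1 % m, ab.2 % m), (ab.1 % n, ab.2 % n))) ?_ ?_
  · intro ab hab
    obtain ⟨hr, hdvd⟩ := mem_filter.mp (mem_coe.mp hab)
    rw [mem_coe, mem_product]
    have key : ∀ q : ℕ, 0 < q → q ∣ m * n →
        (ab.1 % q, ab.2 % q) ∈ ((range q) ×ˢ (range q)).filter fun ab => q ∣ ab.1 ^ 2 + ab.2 ^ 2 := by
      intro q hq hqmn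
      refine mem_filter.mpr ⟨mem_product.mpr ⟨mem_range.mpr (Nat.mod_lt _ hq), mem_range.mpr (Nat.mod_lt _ hq)⟩, ?_⟩
      have h1 : q ∣ ab.1 ^ 2 + ab.2 ^ 2 := hqmn.trans hdvd
      have h2 : (ab.1 % q) ^ 2 + (ab.2 % q) ^ 2 ≡ ab.1 ^ 2 + ab.2 ^ 2 [MOD q] :=
        Nat.ModEq.add ((Nat.mod_modEq _ _).pow 2) ((Nat.mod_modEq _ _).pow 2)
      exact (Nat.modEq_zero_iff_dvd.mp (h2.trans (Nat.modEq_zero_iff_dvd.mpr h1)))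
    exact ⟨key m hm (Dvd.intro _ rfl), key n hn (Dvd.intro_left _ rfl)⟩
  · intro ab hab ab' hab' h
    obtain ⟨hr, -⟩ := mem_filter.mp (mem_coe.mp hab)
    obtain ⟨hr', -⟩ := mem_filter.mp (mem_coe.mp hab')
    rw [mem_product, mem_range, mem_range] at hr hr'
    simp only [Prod.mk.injEq] at h
    obtain ⟨⟨h1m, h2m⟩, h1n, h2n⟩ := h
    have e1 : ab.1 ≡ ab'.1 [MOD m * n] :=
      (Nat.modEq_and_modEq_iff_modEq_mul hmn).mp ⟨h1m, h1n⟩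
    have e2 : ab.2 ≡ ab'.2 [MOD m * n] :=
      (Nat.modEq_and_modEq_iff_modEq_mul hmn).mp ⟨h2m, h2n⟩
    exact Prod.ext (Nat.ModEq.eq_of_lt_of_lt e1 hr.1 hr'.1) (Nat.ModEq.eq_of_lt_of_lt e2 hr.2 hr'.2)

/-- **`N(d) ≤ τ(d) d` for squarefree `d`** (`N(p) ≤ 2p` and the Chinese remainder theorem).
[folklore] -/
theorem pairCongrCount_le_of_squarefree :
    ∀ d : ℕ, Squarefree d → pairCongrCount d ≤ #d.divisors * d := by
  intro d
  induction d using Nat.recOnPosPrimePosCoprime with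
  | zero => intro h; exact absurd h (by simp)
  | one => intro _; decide
  | prime_pow p k hp hk =>
    intro hsq
    have hk1 : k = 1 := by
      rcases hsq.eq_zero_or_one_of_pow_of_not_isUnit
        (by rw [Nat.isUnit_iff]; exact hp.ne_one) with h | h
      · omega
      · exact h
    subst hk1
    rw [pow_one] at *
    rw [hp.divisors, card_pair hp.ne_one.symm]
    exact pairCongrCount_prime_le hp
  | coprime a b ha hb hab iha ihb =>
    intro hsq
    obtain ⟨-, hsa, hsb⟩ := Nat.squarefree_mul_iff.mp hsq
    calc pairCongrCount (a * b) ≤ pairCongrCount a * pairCongrCount b :=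
          pairCongrCount_mul_le (by omega) (by omega) hab
      _ ≤ (#a.divisors * a) * (#b.divisors * b) := Nat.mul_le_mul (iha hsa) (ihb hsb)
      _ = #(a * b).divisors * (a * b) := by rw [Nat.Coprime.card_divisors_mul hab]; ring

end Literature.NumberTheory.Sieve.FriedlanderIwaniecPrimes
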